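import Literature.Computability.QuantumComplexity.HybridArgument
import HarnessLib

/-!
# The BBBV hybrid argument for a set of modified strings (Bennett–Bernstein–Brassard–Vazirani 1997, Thm. 3.3 / Cor. 3.4)

Topic `Computability/QuantumComplexity` (family `quantum-advantage`). `HybridArgument.lean` proves
Fortnow–Rogers' Thm. 4.3 (BBBV, Cor. 3.4): for an oracle circuit with `T` query gates run under the
oracle `A`, and `ε > 0`, there is a set `S` of strings, `|S| ≤ 4T²/ε²`, such that changing the
oracle on ONE string outside `S` moves the output state (hence every outcome probability) by at
most `ε`. BBBV's Thm. 3.3 is about modifying the oracle on a SET of (time, string) pairs of small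
total query magnitude; this file records the corresponding many-strings form of Cor. 3.4, which
is what a deterministic simulator needs when SEVERAL oracle strings are unknown to it (the use made
of Thm. 4.3 in the tree's proof of Fortnow–Rogers' Thm. 4.2, `P^C = BQP^C ≠ UP^C ∩ coUP^C`):

* `queryWeight_coe_finset`, `sum_queryWeights_coe_finset` — query magnitudes are additive over the
  strings of a finite set (distinct strings have disjoint query events);
* `exists_finset_l2Norm_runOn_sub_le_of_card_le` — for every `ε > 0` and every bound `m` there is
  a set `S` of strings of length `< N` (the number of wires), `|S| ≤ 4T²m/ε²`, such that for every
  oracle `B` that agrees with `A` outside a set `D` of at most `m` strings DISJOINT from `S`,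
  `‖U^B_C ψ − U^A_C ψ‖₂ ≤ ε` (`S` = the strings of total query magnitude `≥ ε²/(4Tm)`; then
  `∑_{y ∈ D} ∑_t q_y ≤ m · ε²/(4Tm)` and Thm. 3.3 gives `2√(T · ε²/4T) = ε`);
* `QCircuit.exists_finset_abs_acceptProb_sub_le_of_card_le`,
  `QCircuitFamily.exists_finset_abs_acceptProbOn_sub_le_of_card_le` — the same for acceptance
  probabilities (via the one-event form of BBBV's Thm. 3.1, `QCircuit.abs_acceptProb_sub_le`), over
  any unitary gate set, and `exists_finset_abs_acceptProb_sub_le_of_card_le_cliffordT` for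
  Clifford+T (the gate set of `BQPRel`).

For `m = 1` these are the statements of `HybridArgument.lean` (with `D = {y}`).

## Sources

* [BennettBernsteinBrassardVazirani1997] C. H. Bennett, E. Bernstein, G. Brassard, U. Vazirani,
  *Strengths and weaknesses of quantum computing*, SIAM J. Comput. 26 (1997) 1510–1523
  (arXiv:quant-ph/9701001, pp. 7–8): Def. 3.2 (query magnitude), Thm. 3.3 ("Let `F` be a set of
  time-strings pairs such that `∑_{(i,y)∈F} q_y(|φ_i⟩) ≤ ε²/T`. … then `| |φ_T⟩ − |φ'_T⟩ | ≤ ε`"),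
  Cor. 3.4 and its proof (counting the strings of query magnitude above a threshold).
* [FortnowRogers1999JCSS] L. Fortnow, J. Rogers, *Complexity limitations on quantum computation*,
  JCSS 59 (1999), arXiv:cs/9811023, Thm. 4.3 and its use in the proof of Thm. 4.2 (p. 7).
-/

noncomputable section

namespace Literature.Computability.QuantumComplexity

open Matrix

variable {G : Cryptography.QGateSet} {N k : ℕ}

/-! ### Query magnitudes are additive over finite sets of strings -/

/-- The query magnitude of a finite set of strings is the sum of the query magnitudes of its
elements (the events "the query register spells `y`" are disjoint for distinct `y`).
[cite: BennettBernsteinBrassardVazirani1997, Def. 3.2] -/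
theorem queryWeight_coe_finset (D : Finset (List Bool)) (e : Fin (k + 1) ↪ Fin N)
    (ψ : Cryptography.QReg N → ℂ) :
    queryWeight (↑D : Set (List Bool)) e ψ = ∑ y ∈ D, queryWeight ({y} : Set (List Bool)) e ψ := by
  classical
  unfold queryWeight
  rw [Finset.sum_comm]
  refine Finset.sum_congr rfl fun x _ => ?_
  simp only [Finset.mem_coe, Set.mem_singleton_iff]
  rw [Finset.sum_ite_eq]

/-- Along a run, the query magnitudes of a finite set of strings add up from those of its
elements: `∑_t q_D(|φ_t⟩) = ∑_{y ∈ D} ∑_t q_y(|φ_t⟩)`. [cite: BennettBernsteinBrassardVazirani1997, Def. 3.2] -/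
theorem sum_queryWeights_coe_finset (A : Language Bool) (D : Finset (List Bool)) :
    ∀ (gs : List (Cryptography.QGate G N)) (ψ : Cryptography.QReg N → ℂ),
      (queryWeights A (↑D : Set (List Bool)) gs ψ).sum =
        ∑ y ∈ D, (queryWeights A ({y} : Set (List Bool)) gs ψ).sum
  | [], ψ => by simp [queryWeights]
  | g :: gs, ψ => by
    simp only [queryWeights, List.sum_append, Finset.sum_add_distrib,
      sum_queryWeights_coe_finset A D gs]
    cases g with
    | gate g e => simp [Cryptography.QGate.queryWeights]
    | oracle k e => simp [Cryptography.QGate.queryWeights, queryWeight_coe_finset]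

/-! ### BBBV for a set of at most `m` modified strings -/

/-- **BBBV, Thm. 3.3 / Cor. 3.4 for a set of modified strings (state-vector form).** Over a unitary
gate set, for a circuit `C` on `N` wires with `T` oracle gates run on a unit vector `ψ` under the
oracle `A`, for every `ε > 0` and every `m` there is a set `S` of strings of length `< N` with
`|S| ≤ 4T²m/ε²` such that for every oracle `B` that agrees with `A` outside a set `D` of at most `m`
strings disjoint from `S`, `‖U^B_C ψ − U^A_C ψ‖₂ ≤ ε`. (`S` = the strings of total query magnitude
`≥ ε²/(4Tm)`; their number is at most `T / (ε²/4Tm)` because the total query magnitude of all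
strings is `≤ T`; for `D` as stated `∑_{y∈D} ∑_t q_y < m · ε²/(4Tm) = ε²/4T`, and the hybrid bound
`‖U^B ψ − U^A ψ‖₂ ≤ ∑_t 2√(q_D(|φ_t⟩)) ≤ 2√(T ∑_t q_D(|φ_t⟩))` is `≤ ε`.)
[cite: BennettBernsteinBrassardVazirani1997, Thm. 3.3 and Cor. 3.4] -/
theorem exists_finset_l2Norm_runOn_sub_le_of_card_le (hG : G.IsUnitary) (C : Cryptography.QCircuit G N)
    (A : Language Bool) (ψ : Cryptography.QReg N → ℂ) (hψ : Cryptography.normSq ψ = 1) {ε : ℝ}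
    (hε : 0 < ε) (m : ℕ) :
    ∃ S : Finset (List Bool), (∀ s ∈ S, s.length < N) ∧
      (S.card : ℝ) ≤ 4 * (C.oracleQueries : ℝ) ^ 2 * m / ε ^ 2 ∧
      ∀ (B : Language Bool) (D : Finset (List Bool)), D.card ≤ m → Disjoint D S →
        (∀ w, w ∉ D → (w ∈ A ↔ w ∈ B)) → l2Norm (C.runOn B ψ - C.runOn A ψ) ≤ ε := by
  classical
  obtain ⟨gs⟩ := C
  set T : ℕ := (⟨gs⟩ : Cryptography.QCircuit G N).oracleQueries with hT
  set Q : List Bool → ℝ := fun y => (queryWeights A ({y} : Set (List Bool)) gs ψ).sum with hQ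
  have hQnn : ∀ y, 0 ≤ Q y := fun y => List.sum_nonneg (queryWeights_nonneg A {y} gs ψ)
  -- the hybrid bound for a finite set `D` of modified strings
  have hbound : ∀ (B : Language Bool) (D : Finset (List Bool)),
      (∀ w, w ∉ D → (w ∈ A ↔ w ∈ B)) →
      l2Norm ((⟨gs⟩ : Cryptography.QCircuit G N).runOn B ψ -
          (⟨gs⟩ : Cryptography.QCircuit G N).runOn A ψ) ≤
        2 * Real.sqrt (T * ∑ y ∈ D, Q y) := by
    intro B D hD
    have hAB : ∀ w, w ∉ (↑D : Set (List Bool)) → (w ∈ A ↔ w ∈ B) := fun w hw =>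
      hD w (by simpa using hw)
    refine (l2Norm_toMatrix_sub_le hG hAB gs ψ).trans ?_
    have h := sum_map_two_mul_sqrt_le (queryWeights A (↑D : Set (List Bool)) gs ψ)
      (queryWeights_nonneg A _ gs ψ)
    rwa [length_queryWeights, sum_queryWeights_coe_finset] at h
  -- degenerate cases: no oracle gate, or no modified string
  by_cases hT0 : T = 0
  · refine ⟨∅, by simp, by simp; positivity, fun B D _ _ hD => (hbound B D hD).trans ?_⟩
    rw [hT0, Nat.cast_zero, zero_mul, Real.sqrt_zero, mul_zero]
    exact hε.le
  by_cases hm0 : m = 0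
  · refine ⟨∅, by simp, by simp; positivity, fun B D hDm _ hD => (hbound B D hD).trans ?_⟩
    have hD0 : D = ∅ := Finset.card_eq_zero.1 (Nat.le_zero.1 (hm0 ▸ hDm))
    rw [hD0, Finset.sum_empty, mul_zero, Real.sqrt_zero, mul_zero]
    exact hε.le
  have hTpos : (0 : ℝ) < T := by exact_mod_cast Nat.pos_of_ne_zero hT0
  have hmpos : (0 : ℝ) < m := by exact_mod_cast Nat.pos_of_ne_zero hm0
  set θ : ℝ := ε ^ 2 / (4 * T * m) with hθ
  have hθpos : 0 < θ := by positivity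
  have hTθ : (T : ℝ) * (m * θ) = (ε / 2) ^ 2 := by
    rw [hθ]
    field_simp
    ring
  set Y : Finset (List Bool) := (List.finite_length_lt Bool N).toFinset with hY
  have hYmem : ∀ y, y ∈ Y ↔ y.length < N := fun y => by rw [hY, Set.Finite.mem_toFinset]; rfl
  refine ⟨Y.filter (fun y => θ ≤ Q y), fun s hs => (hYmem s).1 (Finset.mem_filter.1 hs).1, ?_, ?_⟩
  · -- counting: `|S| θ ≤ ∑_{y ∈ S} Q y ≤ ∑_{y ∈ Y} Q y ≤ T`
    have h1 : ((Y.filter fun y => θ ≤ Q y).card : ℝ) * θ ≤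
        ∑ y ∈ Y.filter (fun y => θ ≤ Q y), Q y := by
      rw [← nsmul_eq_mul, ← Finset.sum_const]
      exact Finset.sum_le_sum fun y hy => (Finset.mem_filter.1 hy).2
    have h2 : ∑ y ∈ Y.filter (fun y => θ ≤ Q y), Q y ≤ ∑ y ∈ Y, Q y :=
      Finset.sum_le_sum_of_subset_of_nonneg (Finset.filter_subset _ _) fun y _ _ => hQnn y
    have h3 : ∑ y ∈ Y, Q y ≤ T * Cryptography.normSq ψ := sum_sum_queryWeights_le hG A Y gs ψ
    rw [hψ, mul_one] at h3
    have h4 : ((Y.filter fun y => θ ≤ Q y).card : ℝ) * θ ≤ T := h1.trans (h2.trans h3)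
    rw [le_div_iff₀ (by positivity)]
    calc ((Y.filter fun y => θ ≤ Q y).card : ℝ) * ε ^ 2
        = ((Y.filter fun y => θ ≤ Q y).card : ℝ) * θ * (4 * T * m) := by
          rw [hθ]
          field_simp
      _ ≤ T * (4 * T * m) := by gcongr
      _ = 4 * (T : ℝ) ^ 2 * m := by ring
  · intro B D hDm hDS hD
    refine (hbound B D hD).trans ?_
    -- every modified string has small total query magnitude
    have hQy : ∀ y ∈ D, Q y ≤ θ := by
      intro y hyD
      by_cases hyY : y ∈ Y
      · by_contra h
        exact Finset.disjoint_left.1 hDS hyD (Finset.mem_filter.2 ⟨hyY, (not_le.1 h).le⟩)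
      · have hlen : N ≤ y.length := not_lt.1 fun h => hyY ((hYmem y).2 h)
        rw [show Q y = 0 from sum_queryWeights_eq_zero_of_le_length A hlen gs ψ]
        exact hθpos.le
    have hsum : ∑ y ∈ D, Q y ≤ m * θ :=
      calc ∑ y ∈ D, Q y ≤ ∑ _y ∈ D, θ := Finset.sum_le_sum hQy
        _ = D.card * θ := by rw [Finset.sum_const, nsmul_eq_mul]
        _ ≤ m * θ := by gcongr
    calc 2 * Real.sqrt (T * ∑ y ∈ D, Q y) ≤ 2 * Real.sqrt (T * (m * θ)) := by gcongr
      _ = ε := by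
        rw [hTθ, Real.sqrt_sq (by positivity)]
        ring

/-- **BBBV for a set of modified strings, acceptance probabilities of a circuit.** Over a unitary
gate set, for a circuit `C` on `n + m₀` wires with `T` oracle gates run on `|x⟩|0^{m₀}⟩` under the
oracle `A`, for every `ε > 0` and every `m` there is a set `S` of strings of length `< n + m₀`,
`|S| ≤ 4T²m/ε²`, such that `|Pr[C^B accepts x] − Pr[C^A accepts x]| ≤ ε` for every oracle `B` that
agrees with `A` outside at most `m` strings avoiding `S`.
[cite: BennettBernsteinBrassardVazirani1997, Thm. 3.3, Cor. 3.4 and Thm. 3.1] -/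
theorem _root_.Literature.Computability.Cryptography.QCircuit.exists_finset_abs_acceptProb_sub_le_of_card_le
    (hG : G.IsUnitary) {n m₀ : ℕ} (C : Cryptography.QCircuit G (n + m₀)) (A : Language Bool)
    (x : Cryptography.QReg n) {ε : ℝ} (hε : 0 < ε) (m : ℕ) :
    ∃ S : Finset (List Bool), (∀ s ∈ S, s.length < n + m₀) ∧
      (S.card : ℝ) ≤ 4 * (C.oracleQueries : ℝ) ^ 2 * m / ε ^ 2 ∧
      ∀ (B : Language Bool) (D : Finset (List Bool)), D.card ≤ m → Disjoint D S →
        (∀ w, w ∉ D → (w ∈ A ↔ w ∈ B)) → |C.acceptProb B x - C.acceptProb A x| ≤ ε := by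
  obtain ⟨S, hSN, hS, h⟩ := exists_finset_l2Norm_runOn_sub_le_of_card_le hG C A
    (Cryptography.basisState (Cryptography.padInput x m₀)) (Cryptography.normSq_basisState _) hε m
  refine ⟨S, hSN, hS, fun B D hDm hDS hD => ?_⟩
  exact (Cryptography.QCircuit.abs_acceptProb_sub_le hG C A B x).trans (h B D hDm hDS hD)

/-- **BBBV for a set of modified strings, circuit families.** For a family `F` over a unitary gate
set, an oracle `A`, an input `x`, `ε > 0` and `m`, with `T` the number of oracle gates of
`F.circ |x|`: there is `S`, `|S| ≤ 4T²m/ε²`, all of whose strings are shorter than the number of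
wires, such that `|Pr[F^B accepts x] − Pr[F^A accepts x]| ≤ ε` whenever `B` agrees with `A` outside at
most `m` strings avoiding `S`. For `m = 1` this is Fortnow–Rogers' Thm. 4.3
(`QCircuitFamily.exists_finset_abs_acceptProbOn_sub_le`).
[cite: BennettBernsteinBrassardVazirani1997, Thm. 3.3 and Cor. 3.4] [cite: FortnowRogers1999JCSS, Thm. 4.3 (arXiv numbering)] -/
theorem _root_.Literature.Computability.Cryptography.QCircuitFamily.exists_finset_abs_acceptProbOn_sub_le_of_card_le
    (hG : G.IsUnitary) (F : Cryptography.QCircuitFamily G) (A : Language Bool) (x : List Bool)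
    {ε : ℝ} (hε : 0 < ε) (m : ℕ) :
    ∃ S : Finset (List Bool), (∀ s ∈ S, s.length < x.length + F.ancillas x.length) ∧
      (S.card : ℝ) ≤ 4 * ((F.circ x.length).oracleQueries : ℝ) ^ 2 * m / ε ^ 2 ∧
      ∀ (B : Language Bool) (D : Finset (List Bool)), D.card ≤ m → Disjoint D S →
        (∀ w, w ∉ D → (w ∈ A ↔ w ∈ B)) → |F.acceptProbOn B x - F.acceptProbOn A x| ≤ ε :=
  (F.circ x.length).exists_finset_abs_acceptProb_sub_le_of_card_le hG A x.get hε m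

/-- The Clifford+T instance (the gate set of `BQPRel`; `cliffordT_isUnitary_holds`) for a single
circuit, in the form consumed by the tree's proof of Fortnow–Rogers' Thm. 4.2.
[cite: FortnowRogers1999JCSS, Thm. 4.3 and proof of Thm. 4.2 (arXiv numbering)] [cite: BennettBernsteinBrassardVazirani1997, Cor. 3.4] -/
theorem exists_finset_abs_acceptProb_sub_le_of_card_le_cliffordT {n m₀ : ℕ}
    (C : Cryptography.QCircuit Cryptography.cliffordT (n + m₀)) (A : Language Bool)
    (x : Cryptography.QReg n) {ε : ℝ} (hε : 0 < ε) (m : ℕ) :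
    ∃ S : Finset (List Bool), (∀ s ∈ S, s.length < n + m₀) ∧
      (S.card : ℝ) ≤ 4 * (C.oracleQueries : ℝ) ^ 2 * m / ε ^ 2 ∧
      ∀ (B : Language Bool) (D : Finset (List Bool)), D.card ≤ m → Disjoint D S →
        (∀ w, w ∉ D → (w ∈ A ↔ w ∈ B)) → |C.acceptProb B x - C.acceptProb A x| ≤ ε :=
  C.exists_finset_abs_acceptProb_sub_le_of_card_le Cryptography.cliffordT_isUnitary_holds A x hε m

end Literature.Computability.QuantumComplexity

end
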